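/-
Copyright (c) 2026. All rights reserved.
Released under Apache 2.0 license as described in the file LICENSE.
Authors: abc-iut cell — seat abc-iut-w4-d104 (gen 4): row «COR29-L-A-ENGAGE» part (A), general form — the
re-charting lemma: a linearising chart for the input additive structures DIFFERENT from the function chart.
-/
import Literature.AnabelianGeometry.AbsoluteAnabelian.ArchimedeanReconstructionCor29AdditiveInput
import Literature.AnabelianGeometry.AbsoluteAnabelian.ArchimedeanReconstructionCor29GlobaliseBridge
import HarnessLib

/-!
# [AbsTopIII] Cor 2.9 with INPUT local additive structures linear in a chart of their own (re-charting)

S. Mochizuki, *Topics in absolute anabelian geometry III* (bib key `MochizukiAbsTopIII2015`), Cor 2.9 (a)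
p.64 l.44 – p.65 l.2.  PROOF-ONLY file (no definitions); discharges the `TODO(general form)` of
`…Cor29AdditiveInput.lean` (p442782), where the INPUT local additive structures `+ₓ`, `(1/n)·ₓ` (Cor 2.7 (c))
had to be linear in THE chart `e_x` of the function package.  Print's situation is: the additive structure is
linear in the uniformising coordinate `ψ_x` of `E` pulled back to `x` (abc-iut-w6-d024's
`Cor27c.localAdd_planar_of_isPuncturedEllipticCurve`, p443220), the NF-rational functions are holomorphic in
the Cor 2.8 (b) chart `e_x`, and the two charts differ by a BI-HOLOMORPHIC transition.  This file proves that
this general configuration reduces to p442782 by RE-CHARTING the function package along the transition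
(chain rule):

* `Cor29ChartPackage.chartExpr_rechart` — a chart expression `G` of a value function in the chart `e`
  becomes the chart expression `G ∘ (e ∘ ψ⁻¹)` in the chart `ψ`, differentiable at `ψ x` when the transition
  `e ∘ ψ⁻¹` is;
* `Cor29ChartPackage.deriv_transition_ne_zero` — a transition with a differentiable inverse transition has
  non-zero derivative (so uniformisers stay uniformisers: `deriv_rechart_ne_zero`);
* `NFCurveData.globalArchimedeanCompatibility'_of_two_chartPackages` — abc-iut-L4-t4's successor statement
  of record for the genuine datum, ANY `L`, with the function package `(W¹, e, e′, r¹, G)` carrying the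
  analytic hypotheses and a SECOND package `(W², ψ, ψ′, r²)` at the NF-points linearising the INPUT additive
  structures, the transitions `e_x ∘ ψ_x⁻¹`, `ψ_x ∘ e_x⁻¹` being ℂ-differentiable at the base points.

HONEST SCOPE as p442782: all analytic inputs are NAMED binders (chart packages = analytic structure of
`X_v(k_v)`); refereed pre-IUT material; nothing here bears on the disputed [IUTchIII] Cor. 3.12; typed ≠ endorsed.
-/

noncomputable section

namespace Literature.AnabelianGeometry.AbsoluteAnabelian

open _root_.Set _root_.Topology _root_.Filter _root_.Metric _root_.Function
open ArchimedeanReconstruction ArchimedeanReconstruction.Cor29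

namespace ArchimedeanReconstruction.Cor29ChartPackage

variable {X : Type} [TopologicalSpace X]
variable {W₁ W₂ : Set X} {e ψ : X → ℂ} {e' ψ' : ℂ → X} {x : X} {r₂ : ℝ}

section Values

variable {𝕜 : Type*} [NontriviallyNormedField 𝕜]

/-- **Re-charting a chart expression**: if the `𝕜`-valued `F` reads `κ⁻¹ ∘ F = G ∘ e` near `x` with `G`
ℂ-differentiable at `e x`, and `ψ` is a second chart at `x` (inverse `ψ′` on its domain `W² ∋ x`) whose
transition `e ∘ ψ′` is ℂ-differentiable at `ψ x`, then `κ⁻¹ ∘ F = (G ∘ e ∘ ψ′) ∘ ψ` near `x` with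
`G ∘ e ∘ ψ′` ℂ-differentiable at `ψ x` (chain rule). [cite: MochizukiAbsTopIII2015, Corollary 2.9 (a) p.65] -/
theorem chartExpr_rechart (κ : ℂ ≃+* 𝕜) (hW₂ : IsOpen W₂) (hxW₂ : x ∈ W₂) (hl₂ : ∀ v ∈ W₂, ψ' (ψ v) = v)
    {F : X → 𝕜} {G : ℂ → ℂ} (hG : DifferentiableAt ℂ G (e x))
    (hFG : ∀ᶠ u in 𝓝 x, κ.symm (F u) = G (e u))
    (hT : DifferentiableAt ℂ (fun z => e (ψ' z)) (ψ x)) :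
    DifferentiableAt ℂ (fun z => G (e (ψ' z))) (ψ x) ∧
      ∀ᶠ u in 𝓝 x, κ.symm (F u) = (fun z => G (e (ψ' z))) (ψ u) := by
  have hx : e (ψ' (ψ x)) = e x := by rw [hl₂ x hxW₂]
  refine ⟨?_, ?_⟩
  · have hG' : DifferentiableAt ℂ G ((fun z => e (ψ' z)) (ψ x)) := by
      simp only [hx]; exact hG
    exact hG'.comp (ψ x) hT
  · filter_upwards [hFG, hW₂.mem_nhds hxW₂] with u hu huW
    simp only [hl₂ u huW, hu]

omit [TopologicalSpace X] in
/-- **A transition with a differentiable inverse transition has non-zero derivative**: if `e ∘ ψ′` is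
ℂ-differentiable at `ψ x`, `ψ ∘ e′` is ℂ-differentiable at `e x`, and `ψ ∘ e′ ∘ e ∘ ψ′ = id` near `ψ x`, then
`(e ∘ ψ′)′(ψ x) ≠ 0`. [cite: MochizukiAbsTopIII2015, Corollary 2.9 (a) p.65] -/
theorem deriv_transition_ne_zero (hxe : e (ψ' (ψ x)) = e x)
    (hT : DifferentiableAt ℂ (fun z => e (ψ' z)) (ψ x))
    (hS : DifferentiableAt ℂ (fun w => ψ (e' w)) (e x))
    (hinv : ∀ᶠ z in 𝓝 (ψ x), ψ (e' (e (ψ' z))) = z) :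
    deriv (fun z => e (ψ' z)) (ψ x) ≠ 0 := by
  intro h0
  have hS' : DifferentiableAt ℂ (fun w => ψ (e' w)) ((fun z => e (ψ' z)) (ψ x)) := by
    simp only [hxe]; exact hS
  have hcomp : deriv ((fun w => ψ (e' w)) ∘ (fun z => e (ψ' z))) (ψ x) =
      deriv (fun w => ψ (e' w)) ((fun z => e (ψ' z)) (ψ x)) * deriv (fun z => e (ψ' z)) (ψ x) :=
    deriv_comp (ψ x) hS' hT
  have heq : ((fun w => ψ (e' w)) ∘ (fun z => e (ψ' z))) =ᶠ[𝓝 (ψ x)] id :=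
    hinv.mono fun z hz => hz
  have hid : deriv ((fun w => ψ (e' w)) ∘ (fun z => e (ψ' z))) (ψ x) = 1 := by
    rw [heq.deriv_eq]
    exact deriv_id (ψ x)
  rw [hid, h0, mul_zero] at hcomp
  exact one_ne_zero hcomp

/-- The eventual identity `ψ (e′ (e (ψ′ z))) = z` near `ψ x` for two chart packages at `x`: `ψ′` is continuous
at `ψ x` with value `x ∈ W¹`, so `ψ′ z ∈ W¹ ∩ W²`-images behave. (Auxiliary.)
[cite: MochizukiAbsTopIII2015, Corollary 2.9 (a) p.65] -/
theorem eventually_transition_inverse (hr₂ : 0 < r₂) (hW₁ : IsOpen W₁) (hxW₁ : x ∈ W₁) (hxW₂ : x ∈ W₂)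
    (hl₁ : ∀ v ∈ W₁, e' (e v) = v) (hψ'c : ContinuousOn ψ' (ball (ψ x) r₂))
    (hl₂ : ∀ v ∈ W₂, ψ' (ψ v) = v) (hrt₂ : ∀ w ∈ ball (ψ x) r₂, ψ (ψ' w) = w) :
    ∀ᶠ z in 𝓝 (ψ x), ψ (e' (e (ψ' z))) = z := by
  -- `ψ′ z → ψ′ (ψ x) = x ∈ W¹` as `z → ψ x` inside the ball
  have hcont : ContinuousAt ψ' (ψ x) := (hψ'c (ψ x) (mem_ball_self hr₂)).continuousAt
    (isOpen_ball.mem_nhds (mem_ball_self hr₂))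
  have hx' : ψ' (ψ x) = x := hl₂ x hxW₂
  have hmem : ∀ᶠ z in 𝓝 (ψ x), ψ' z ∈ W₁ := by
    have h := hcont.preimage_mem_nhds (hW₁.mem_nhds (by rw [hx']; exact hxW₁))
    exact h
  filter_upwards [hmem, isOpen_ball.mem_nhds (mem_ball_self hr₂)] with z hz hzb
  rw [hl₁ _ hz, hrt₂ z hzb]

/-- **Uniformisers survive re-charting**: with the transition differentiable both ways,
`(G ∘ e ∘ ψ′)′(ψ x) = G′(e x) · (e ∘ ψ′)′(ψ x)` is non-zero when `G′(e x)` is.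
[cite: MochizukiAbsTopIII2015, Corollary 2.9 (a) p.65] -/
theorem deriv_rechart_ne_zero (hr₂ : 0 < r₂) (hW₁ : IsOpen W₁) (hxW₁ : x ∈ W₁) (hxW₂ : x ∈ W₂)
    (hl₁ : ∀ v ∈ W₁, e' (e v) = v) (hψ'c : ContinuousOn ψ' (ball (ψ x) r₂))
    (hl₂ : ∀ v ∈ W₂, ψ' (ψ v) = v) (hrt₂ : ∀ w ∈ ball (ψ x) r₂, ψ (ψ' w) = w)
    {G : ℂ → ℂ} (hG : DifferentiableAt ℂ G (e x)) (hd : deriv G (e x) ≠ 0)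
    (hT : DifferentiableAt ℂ (fun z => e (ψ' z)) (ψ x))
    (hS : DifferentiableAt ℂ (fun w => ψ (e' w)) (e x)) :
    deriv (fun z => G (e (ψ' z))) (ψ x) ≠ 0 := by
  have hxe : e (ψ' (ψ x)) = e x := by rw [hl₂ x hxW₂]
  have hG' : DifferentiableAt ℂ G ((fun z => e (ψ' z)) (ψ x)) := by simp only [hxe]; exact hG
  have hcomp : deriv (G ∘ (fun z => e (ψ' z))) (ψ x) =
      deriv G ((fun z => e (ψ' z)) (ψ x)) * deriv (fun z => e (ψ' z)) (ψ x) :=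
    deriv_comp (ψ x) hG' hT
  rw [show (fun z => G (e (ψ' z))) = G ∘ (fun z => e (ψ' z)) from rfl, hcomp]
  simp only [hxe]
  exact mul_ne_zero hd (deriv_transition_ne_zero hxe hT hS
    (eventually_transition_inverse hr₂ hW₁ hxW₁ hxW₂ hl₁ hψ'c hl₂ hrt₂))

end Values

end ArchimedeanReconstruction.Cor29ChartPackage

/-! ## Cor 2.9 for the genuine datum with two chart packages: functions in `e_x`, additive structure in `ψ_x` -/

namespace ArchimedeanReconstruction

open Cor29 Cor29ChartPackage

open Classical in
/-- **[AbsTopIII] Cor 2.9, abc-iut-L4-t4's successor statement of record, for the GENUINE datum, ANY `L`, with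
the INPUT local additive structures linear in a chart package OF THEIR OWN** — the general form of p442782:
the NF-rational functions have ℂ-differentiable expressions `G x f` in the function charts `e_x` (package
`W¹, e, e′, r¹`, with a uniformiser), the input `+ₓ`, `(1/n)·ₓ` are linear in second charts `ψ_x` (package
`W², ψ, ψ′, r²`), and the transitions `e_x ∘ ψ_x⁻¹`, `ψ_x ∘ e_x⁻¹` are ℂ-differentiable at the base points
(print: both are holomorphic coordinates of `X_v(k_v)` at `x`).  Conclusion: the statement of record with the
data read in the LINEARISING charts `ψ_x` (`df|_x := κ((G x f ∘ e_x ∘ ψ_x⁻¹)′(ψ_x x))`, `ι`, germ multipliers).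
[cite: MochizukiAbsTopIII2015, Corollary 2.9 pp.64–65] -/
theorem NFCurveData.globalArchimedeanCompatibility'_of_two_chartPackages (D : NFCurveData)
    (L : LocalLinearHolStructure D.Xtop) (isNFPoint : D.Xtop → Prop)
    -- the function package
    (W₁ : D.Xtop → Set D.Xtop) (e : D.Xtop → D.Xtop → ℂ) (e' : D.Xtop → ℂ → D.Xtop)
    (hW₁ : ∀ x, isNFPoint x → IsOpen (W₁ x) ∧ x ∈ W₁ x)
    (hl₁ : ∀ x, isNFPoint x → ∀ v ∈ W₁ x, e' x (e x v) = v)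
    (fval : D.Fn → D.Xtop → D.kv) (vanishesAt : D.Fn → D.Xtop → Prop) (G : D.Xtop → D.Fn → ℂ → ℂ)
    (κ : ℂ ≃+* D.kv) (hκ : Continuous κ) (hκ' : Continuous κ.symm)
    (hG : ∀ x, isNFPoint x → ∀ f, vanishesAt f x → DifferentiableAt ℂ (G x f) (e x x) ∧
      (∀ᶠ u in 𝓝 x, κ.symm (fval f u) = G x f (e x u)) ∧ fval f x = 0)
    (hvan : ∀ f x, vanishesAt f x → fval f x = 0)
    (hspan : ∀ x, isNFPoint x → ∃ f, vanishesAt f x ∧ deriv (G x f) (e x x) ≠ 0)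
    -- the linearising package for the INPUT additive structures
    (W₂ : D.Xtop → Set D.Xtop) (ψ : D.Xtop → D.Xtop → ℂ) (ψ' : D.Xtop → ℂ → D.Xtop) (r₂ : D.Xtop → ℝ)
    (hr₂ : ∀ x, isNFPoint x → 0 < r₂ x) (hW₂ : ∀ x, isNFPoint x → IsOpen (W₂ x) ∧ x ∈ W₂ x)
    (hψ : ∀ x, isNFPoint x → ContinuousOn (ψ x) (W₂ x) ∧ MapsTo (ψ x) (W₂ x) (ball (ψ x x) (r₂ x)))
    (hψ' : ∀ x, isNFPoint x →
      ContinuousOn (ψ' x) (ball (ψ x x) (r₂ x)) ∧ MapsTo (ψ' x) (ball (ψ x x) (r₂ x)) (W₂ x))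
    (hl₂ : ∀ x, isNFPoint x → ∀ v ∈ W₂ x, ψ' x (ψ x v) = v)
    (hrt₂ : ∀ x, isNFPoint x → ∀ w ∈ ball (ψ x x) (r₂ x), ψ x (ψ' x w) = w)
    (ladd₀ : D.Xtop → D.Xtop → D.Xtop → D.Xtop) (scale₀ : D.Xtop → ℕ → D.Xtop → D.Xtop)
    (hladd : ∀ x, isNFPoint x → ∀ a ∈ W₂ x, ∀ b ∈ W₂ x, ladd₀ x a b = ψ' x (ψ x a + ψ x b - ψ x x))
    (hscale : ∀ x, isNFPoint x → ∀ n : ℕ, 0 < n → ∀ v ∈ W₂ x,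
      scale₀ x n v = ψ' x (ψ x x + (ψ x v - ψ x x) / (n : ℂ)))
    -- the transitions are ℂ-differentiable at the base points
    (hT : ∀ x, isNFPoint x → DifferentiableAt ℂ (fun z => e x (ψ' x z)) (ψ x x))
    (hS : ∀ x, isNFPoint x → DifferentiableAt ℂ (fun w => ψ x (e' x w)) (e x x)) :
    GlobalArchimedeanCompatibility' D L isNFPoint (fun _ => D.kv)
      (fun x f => κ (deriv (fun z => G x f (e x (ψ' x z))) (ψ x x)))
      vanishesAt ladd₀ (fun x n v => if v ∈ W₂ x ∧ ‖ψ x v - ψ x x‖ < r₂ x / 2 then scale₀ x n v else x) fval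
      (fun x u v => ψ' x (ψ x x + ((((L.isoUnits x).symm u : ℂˣ) : ℂ) * (ψ x v - ψ x x)))) := by
  refine D.globalArchimedeanCompatibility'_of_chartPackage_input L isNFPoint W₂ ψ ψ' r₂ hr₂ hW₂ hψ hψ' hl₂
    hrt₂ ladd₀ scale₀ hladd hscale fval vanishesAt (fun x f z => G x f (e x (ψ' x z))) κ hκ hκ'
    (fun x hx f hf => ?_) hvan (fun x hx => ?_)
  · obtain ⟨hGd, hFG, hf0⟩ := hG x hx f hf
    obtain ⟨hd, hev⟩ := chartExpr_rechart κ (hW₂ x hx).1 (hW₂ x hx).2 (hl₂ x hx) hGd hFG (hT x hx)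
    exact ⟨hd, hev, hf0⟩
  · obtain ⟨f, hf, hd⟩ := hspan x hx
    exact ⟨f, hf, deriv_rechart_ne_zero (hr₂ x hx) (hW₁ x hx).1 (hW₁ x hx).2 (hW₂ x hx).2 (hl₁ x hx)
      (hψ' x hx).1 (hl₂ x hx) (hrt₂ x hx) (hG x hx f hf).1 hd (hT x hx) (hS x hx)⟩

end ArchimedeanReconstruction

end Literature.AnabelianGeometry.AbsoluteAnabelian

end
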